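import Summits.FinalStateConjecture.FinalStateConjecture.Theses.PhotonSphereChannels
import Summits.FinalStateConjecture.FinalStateConjecture.Theses.CurvatureOrSymmetry
import Summits.FinalStateConjecture.FinalStateConjecture.Theorems.TameCensorship.Negative.BoostBlindness
import Literature.Geometry.Lorentzian.TameGenericityDiagonal
import Literature.Geometry.Lorentzian.LeviCivitaProofs

/-!
# Line `tame-outer-censors` — skeleton for the crux `PhotonSphereChannels.TameCensorship`
(crux item stmt-FinalStateConjecture-10047, K3; planner crux-plan seat, round 2; idea card
`Cruxes/TameCensorship/Ideas/tame-outer-censors.md`, triage `TRIAGE-r2-1.md` / `TRIAGE-r2-2.md`: pass ×2)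

THE LINE. K3 — RE-TYPED 2026-08-16T23:19Z (route rev 15, repair T2 after Statement p126844) to
TAME Christodoulou genericity `IsTameChristodoulouGeneric … 1`, same decl name, same item, same
bundled property — asserts, tame-generically on the admissible class: an MGHD exists, and every
MGHD has (a) complete `𝓘⁺`, (i) no extremal late chart, (ii) `C³`-bounded geometry of the outer
region `outer = J⁺(ιΣ) ∩ ⋃ I⁻(future-complete normalised rays)` at a uniform coordinate scale
(`C⁰`-deviation `≤ ½`, `C³`-deviation `≤ Λ`). The line deletes clause (a) from the kernel list by the
POINTWISE implication (ii) ⇒ (a) for every admissible datum and every MGHD (`TameOuterCensors`,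
no genericity — the one move tame curve-genericity tolerates, monotonicity
`IsTameChristodoulouGeneric.mono`), decomposed as pure logic:

* `stub_pancakeLaw` (the LEVER, provable Lorentzian analysis, size L): a tame chart of `η`-radius
  `r₀` centred at a point `γ t` of a VISIBLE future-incomplete null geodesic `γ` (remaining affine
  length `ε = sSup dom − t`) sees `γ' t` with chart size `u ≥ c(Λ, r₀)/ε` (the geodesic must leave
  the half-ball before it dies: forced boost, the converse reading of Negative/BoostBlindness §9);
  reading the chart bound `|Riem| ≤ C(Λ, r₀)` through that boost gives the u-COUPLED WEIGHT TABLE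
  `HasTameEnd`: a null frame `(ℓ = γ' t, n, e₂, e₃)` at `γ t` and `u ≥ (C ε)⁻¹` with
  `|R(f_a, f_b, f_c, f_d)| ≤ C · u ^ (#ℓ-slots − #n-slots)` — n-heavy components `O(ε²)`, `O(ε)`,
  weight zero `O(1)`, every scalar curvature invariant bounded, ℓ-heavy components bounded only
  through the chart's actual boost (no upper bound on `u` follows from (ii): tangent null slabs may
  be arbitrarily long — correction of the card's "rate `ε⁻²`", see the line card).
* `stub_noTameWhimpers` (the KERNEL, open, ∀-data): no MGHD of an admissible datum contains a
  visible future-incomplete null geodesic whose parallel frames see unbounded curvature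
  (alternative (a) of `CurvatureOrSymmetry.NoFourthExit`, verbatim) while `HasTameEnd` holds —
  i.e. no VISIBLE WHIMPER (asymptotically type-N front, principal null direction transverse to `γ`,
  bounded invariants) develops from complete one-ended asymptotically flat vacuum data.
* `CurvatureOrSymmetry.NoFourthExit` (stmt-10210) and `.NoVacuumFountains` (stmt-10211), BY NAME
  (their visibility idiom is verbatim the second factor of `outer`): incomplete `𝓘⁺` ⇒ a visible
  incomplete `γ` ending by curvature (a) or by symmetry (c); (c) ∧ ¬(a) never.
  Hence `tameOuterCensors_of : PancakeLaw → NoTameWhimpers → NoFourthExit → NoVacuumFountains →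
  TameOuterCensors` (PROVED, pure logic).
* `stub_extremalFreeTameOuterGeneric` (the RESIDUAL of K3 once (a) is deleted — owned by the
  sibling lines `reversed-datum-common-probe` ≈ `thresholds-are-transversal`, `far-field-dials`;
  in the crux's own TAME genericity): tame-generically every MGHD satisfies (i) ∧ (ii).
* `CurvatureOrSymmetry.MGHDExistence` (stmt-9937) BY NAME: the existential content of the crux
  (Negative/ExistentialContent `exists_isMaximal_of_tameCensorship`, honoured, not re-stubbed).

`TameCensorship_of` composes the three stubs and the three foreign items into the crux BY NAME
(real proof: `IsTameChristodoulouGeneric.mono`; the literal clauses (i), (ii) are recognised by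
`defeq`). The pre-23:19Z topology-free K3 follows too (`IsTameChristodoulouGeneric.isChristodoulouGeneric`).

Checked against the landed Negative lemmas: `exists_isMaximal_of_tameCensorship` (§3,
Negative/ExistentialContent — not importable at the moment: its `Iff.rfl` read-back is typed against
the pre-23:19Z body; it transfers to the tame K3 by `.isChristodoulouGeneric`) is honoured by
`MGHDExistence` BY NAME; Negative/BoostBlindness (§9, `exists_lorentz_ball_disjoint_translate`, imported)
is the mechanism of `stub_pancakeLaw` read conversely, not contradicted (the stub never asks a
chart to see a short circle or null curvature — it USES that boosted charts are the only ones that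
fit); §4 (`isChristodoulouGeneric_and_fails`) is not invoked (no conjunction of genericities: (a) is
removed pointwise, (i) ∧ (ii) stay ONE generic statement); no `futureCauchyDevelopment` /
`IsPastInextendible` (§10) occurs; no stub is an instance of a landed Negative lemma. No
`_false_without_` theorem exists for K3 (Disproof: crux resists, cycles 1–3); the line's own
load-bearing hypothesis is the `C⁰ ≤ ½` pin of (ii) (slope/invertibility in the chart), used in
`stub_pancakeLaw`.
-/

set_option linter.dupNamespace false

open Literature.Geometry.Lorentzian
open scoped Manifold ContDiff Topology
open Filter Set

noncomputable section

namespace Summit.FinalStateConjecture.FinalStateConjecture.Cruxes.TameCensorship.TameOuterCensors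

open Summit.FinalStateConjecture.FinalStateConjecture.Theses.PhotonSphereChannels (TameCensorship)
open Summit.FinalStateConjecture.FinalStateConjecture.Theses.CurvatureOrSymmetry
  (NoFourthExit NoVacuumFountains MGHDExistence)

/-! ## The clauses of K3, one development at a time (verbatim sub-formulas of the crux) -/

section Clauses

variable {X : Type} [TopologicalSpace X] [ChartedSpace E3 X] [IsManifold (𝓡 3) ∞ X]
  [ConnectedSpace X] {D : InitialDataSet (𝓡 3) X}

/-- Clause (i) of K3 for ONE spacetime (verbatim: no late chart modelled on a boosted EXTREMAL
Kerr exterior with truncated `C²` deviation `→ 0` for every `R`). -/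
def ExtremalChartFree (𝓢 : Spacetime.{0} 4) : Prop :=
  ∀ (Λ : lorentzGroup) (c : E4) (M a : ℝ), Kerr.IsExtremal M a →
    ¬ ∃ (τ₀ : ℝ) (Ψ : (boostedKerrBackground Λ c M a).domain → 𝓢.carrier),
      𝓢.IsLateChart (boostedKerrBackground Λ c M a) Set.univ τ₀ Ψ ∧
        ∀ R : ℝ, Tendsto (fun τ => 𝓢.truncDeviationCk (boostedKerrBackground Λ c M a) Ψ 2 R τ)
          atTop (nhds 0)

/-- Clause (ii) of K3 for ONE Cauchy development (verbatim): every point of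
`outer = J⁺(ιΣ) ∩ ⋃ I⁻(future-complete normalised rays)` is the centre of a late chart from the
Minkowski ball of radius `r₀` with `C³`-deviation `≤ Λ` and `C⁰`-deviation `≤ ½`, for ONE `r₀ > 0`
and ONE `Λ`. -/
def TameOuter (𝒟 : CauchyDevelopment D) : Prop :=
  ∀ [𝒟.metric.HasLeviCivita],
    let outer : Set 𝒟.carrier :=
      𝒟.metric.causalFuture 𝒟.timeOrientation (Set.range 𝒟.embed) ∩
        {q | ∃ (p : X) (γ : ℝ → 𝒟.carrier) (dom : Set ℝ),
          𝒟.metric.IsNormalisedNullRayFrom 𝒟.timeOrientation 𝒟.embed 𝒟.normal p γ dom ∧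
            ¬ BddAbove dom ∧
              q ∈ 𝒟.metric.chronologicalPast 𝒟.timeOrientation (γ '' (dom ∩ Set.Ici 0))}
    ∃ r₀ : ℝ, 0 < r₀ ∧ ∃ Λ : NNReal, ∀ q ∈ outer,
      let U : TopologicalSpace.Opens E4 := ⟨Metric.ball (0 : E4) r₀, Metric.isOpen_ball⟩
      ∃ Ψ : U → 𝒟.carrier,
        𝒟.toSpacetime.IsLateChart (Minkowski.backgroundOn U) Set.univ (-r₀) Ψ ∧
          (∃ x : U, (x : E4) = 0 ∧ Ψ x = q) ∧
            supCkENorm (U : Set E4) 3 (𝒟.toSpacetime.deviationExtend (Minkowski.backgroundOn U) Ψ) ≤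
                (Λ : ENNReal) ∧
              supCkENorm (U : Set E4) 0 (𝒟.toSpacetime.deviationExtend (Minkowski.backgroundOn U) Ψ) ≤
                1 / 2

/-! ## Visible incomplete rays and their ends (the idiom of route CurvatureOrSymmetry, verbatim) -/

/-- `γ` with affine domain `dom` is a VISIBLE FUTURE-INCOMPLETE NULL GEODESIC of `𝒟`: a maximal
geodesic, `0 ∈ dom`, `dom` bounded above, future-directed null velocity, and every `γ t`, `t ≥ 0`,
in the chronological past of the nonnegative-parameter image of some future-COMPLETE normalised
null ray from the data hypersurface — verbatim the first block of `CurvatureOrSymmetry.NoFourthExit`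
(its last conjunct is verbatim the second factor of K3's `outer`). -/
def IsVisibleIncompleteRay (𝒟 : CauchyDevelopment D) [𝒟.metric.HasLeviCivita]
    (γ : ℝ → 𝒟.carrier) (dom : Set ℝ) : Prop :=
  IsMaximalGeodesicOn 𝒟.metric.leviCivita γ dom ∧ (0 : ℝ) ∈ dom ∧ BddAbove dom ∧
    (∀ t ∈ dom, 𝒟.metric.IsNull (velocity (𝓡 4) γ t) ∧
      𝒟.timeOrientation.IsFutureDirected (velocity (𝓡 4) γ t)) ∧
    (∀ t ∈ dom, 0 ≤ t → (∃ (p : X) (δ : ℝ → 𝒟.carrier) (s : Set ℝ),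
      𝒟.metric.IsNormalisedNullRayFrom 𝒟.timeOrientation 𝒟.embed 𝒟.normal p δ s ∧
        ¬ BddAbove s ∧
          γ t ∈ 𝒟.metric.chronologicalPast 𝒟.timeOrientation (δ '' (s ∩ Set.Ici 0))))

/-- Alternative (a) of `NoFourthExit` along `γ` (verbatim): some parallelly propagated frame along
`γ`, linearly independent at `0`, sees unbounded curvature components on `t ≥ 0` — a p.p. curvature
singularity (Hawking–Ellis §8.1). -/
def PPBlowup (𝒟 : CauchyDevelopment D) [𝒟.metric.HasLeviCivita]
    (γ : ℝ → 𝒟.carrier) (dom : Set ℝ) : Prop :=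
  ∃ e : Fin 4 → (Π t : ℝ, TangentSpace (𝓡 4) (γ t)),
    (∀ a, ∀ t ∈ dom, MDifferentiableAt 𝓘(ℝ, ℝ) (𝓡 4).tangent
        (fun s : ℝ ↦ (Bundle.TotalSpace.mk' E4 (γ s) (e a s) : TangentBundle (𝓡 4) 𝒟.carrier)) t ∧
      covariantDerivAlong 𝒟.metric.leviCivita γ (e a) t = 0) ∧
    LinearIndependent ℝ (fun a ↦ e a 0) ∧
    ∀ C : ℝ, ∃ t ∈ dom, 0 ≤ t ∧ ∃ a b c d : Fin 4,
      C < |𝒟.metric.val (γ t)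
        (CovariantDerivative.curvature 𝒟.metric.leviCivita (γ t) (e a t) (e b t) (e c t)) (e d t)|

/-- Alternative (c) of `NoFourthExit` along `γ` (verbatim): a Killing field on an open set around a
tail of `γ` with `g(K, γ') ≡ −1` on the tail and `g(K, K) → 0` at the end (the shadow of a Killing
horizon through a fountain). -/
def KillingShadow (𝒟 : CauchyDevelopment D) [𝒟.metric.HasLeviCivita]
    (γ : ℝ → 𝒟.carrier) (dom : Set ℝ) : Prop :=
  ∃ (U : Set 𝒟.carrier) (K : Π x : 𝒟.carrier, TangentSpace (𝓡 4) x) (t₀ : ℝ),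
    IsOpen U ∧ t₀ ∈ dom ∧ (∀ t ∈ dom, t₀ ≤ t → γ t ∈ U) ∧
    ContMDiffOn (𝓡 4) ((𝓡 4).prod 𝓘(ℝ, E4)) ((⊤ : ℕ∞) : WithTop ℕ∞)
      (fun x ↦ (Bundle.TotalSpace.mk' E4 x (K x) : TangentBundle (𝓡 4) 𝒟.carrier)) U ∧
    (∀ x ∈ U, ∀ v w : TangentSpace (𝓡 4) x,
      𝒟.metric.val x (𝒟.metric.leviCivita K x v) w + 𝒟.metric.val x v (𝒟.metric.leviCivita K x w) = 0) ∧
    (∀ t ∈ dom, t₀ ≤ t → 𝒟.metric.val (γ t) (K (γ t)) (velocity (𝓡 4) γ t) = -1) ∧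
    Tendsto (fun t : ℝ ↦ 𝒟.metric.val (γ t) (K (γ t)) (K (γ t))) (nhdsWithin (sSup dom) dom) (nhds 0)

/-! ## The weight table (what a uniform-scale tame chart can see near a dying visible ray) -/

/-- Boost weight of a frame slot: `+1` for the tangent leg `ℓ = γ'` (slot `0`), `−1` for the
conjugate null leg `n` (slot `1`), `0` for the screen legs `e₂, e₃`. -/
def slotWeight (a : Fin 4) : ℤ := if a = 0 then 1 else if a = 1 then -1 else 0

/-- Total boost weight of a component `R(f_a, f_b, f_c, f_d)`: `#ℓ-slots − #n-slots ∈ [−2, 2]`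
for the non-trivial components. -/
def boostWeight (a b c d : Fin 4) : ℤ := slotWeight a + slotWeight b + slotWeight c + slotWeight d

/-- `f` is a NULL FRAME AT `x` ADAPTED TO `ℓ`: `f 0 = ℓ` and `f 1` are null with
`g(f 0, f 1) = −1`, `f 2, f 3` are orthonormal spacelike and `g`-orthogonal to both null legs. -/
def IsAdaptedNullFrame (𝒟 : CauchyDevelopment D) (x : 𝒟.carrier) (ℓ : TangentSpace (𝓡 4) x)
    (f : Fin 4 → TangentSpace (𝓡 4) x) : Prop :=
  f 0 = ℓ ∧ 𝒟.metric.val x (f 0) (f 0) = 0 ∧ 𝒟.metric.val x (f 1) (f 1) = 0 ∧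
    𝒟.metric.val x (f 0) (f 1) = -1 ∧
    𝒟.metric.val x (f 2) (f 2) = 1 ∧ 𝒟.metric.val x (f 3) (f 3) = 1 ∧ 𝒟.metric.val x (f 2) (f 3) = 0 ∧
    𝒟.metric.val x (f 0) (f 2) = 0 ∧ 𝒟.metric.val x (f 0) (f 3) = 0 ∧
    𝒟.metric.val x (f 1) (f 2) = 0 ∧ 𝒟.metric.val x (f 1) (f 3) = 0

/-- `γ` has a **TAME END** (the u-coupled weight table): there is `C > 0` such that at every
`γ t`, `t ∈ dom`, `t ≥ 0`, some null frame adapted to `γ' t` and some boost parameter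
`u ≥ (C · (sSup dom − t))⁻¹` satisfy `|R(f_a, f_b, f_c, f_d)| ≤ C · u ^ boostWeight a b c d` for all
slots: n-heavy components are `O(ε²)` / `O(ε)` in the remaining affine length `ε = sSup dom − t`,
weight-zero components and every scalar polynomial curvature invariant are bounded, ℓ-heavy
components are bounded by `C u`, `C u²` for the SAME `u`. This is exactly what the chart frames of
clause (ii), read through the forced boost, deliver (`stub_pancakeLaw`). -/
def HasTameEnd (𝒟 : CauchyDevelopment D) [𝒟.metric.HasLeviCivita]
    (γ : ℝ → 𝒟.carrier) (dom : Set ℝ) : Prop :=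
  ∃ C : ℝ, 0 < C ∧ ∀ t ∈ dom, 0 ≤ t →
    ∃ f : Fin 4 → TangentSpace (𝓡 4) (γ t),
      IsAdaptedNullFrame 𝒟 (γ t) (velocity (𝓡 4) γ t) f ∧
      ∃ u : ℝ, (C * (sSup dom - t))⁻¹ ≤ u ∧
        ∀ a b c d : Fin 4,
          |𝒟.metric.val (γ t)
              (CovariantDerivative.curvature 𝒟.metric.leviCivita (γ t) (f a) (f b) (f c)) (f d)| ≤
            C * u ^ boostWeight a b c d

end Clauses

/-! ## The statements of the line -/

/-- **PANCAKE LAW** (stub, the lever; provable Lorentzian analysis, size L). In ANY Cauchy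
development whose outer region is tame at a uniform scale (clause (ii)), every visible
future-incomplete null geodesic has a tame end. Proof route: (1) the tail of `γ` lies in
`J⁺(ιΣ)` (an inextendible causal curve meets the Cauchy hypersurface; maximal geodesics are
`C⁰`-inextendible), so its points lie in `outer` and carry charts; (2) `γ` leaves the compact image
of the closed half-ball of every chart centred on it before it dies (no imprisonment in a globally
hyperbolic spacetime), within affine length `< ε`; (3) in the chart, `|Γ| ≤ K(Λ, r₀)` (inverse metric
from the `C⁰ ≤ ½` pin, first derivatives by interpolation between `C⁰` and `C³` on the ball) and the
arc-length Grönwall inequality give chart size `u := ‖(Ψ⁻¹ ∘ γ)'(t)‖ ≥ (1 − e^{−K r₀/2})/(K ε)`;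
(4) complete `ℓ̂ = γ'/u` to a chart-bounded null frame (`n̂` in the plane of `ℓ̂` and the chart time
axis — a null and a timelike vector are never orthogonal, compactness bounds the frame), rescale
`ℓ = u ℓ̂`, `n = n̂/u`, and read `|Riem_chart| ≤ K` through the rescaling; (5) the compact initial
segment of `γ` (before it enters `J⁺(ιΣ)`) is absorbed into `C`. Flat model (cheapest falsifier of
the card, by hand: an `η`-isometric image of `B(0,r₀)` inside `{u < 0}` through a point with
`u = −ε` has `e^χ ≥ √2 r₀/ε`; TRIAGE-r2-1/2 recomputed it) is the case `K = 0`. -/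
def PancakeLaw : Prop :=
  ∀ (X : Type) [TopologicalSpace X] [ChartedSpace E3 X] [IsManifold (𝓡 3) ∞ X] [T2Space X]
    [SecondCountableTopology X] [ConnectedSpace X],
    ∀ (D : InitialDataSet (𝓡 3) X) (𝒟 : CauchyDevelopment D), ∀ [𝒟.metric.HasLeviCivita],
      TameOuter 𝒟 → ∀ (γ : ℝ → 𝒟.carrier) (dom : Set ℝ),
        IsVisibleIncompleteRay 𝒟 γ dom → HasTameEnd 𝒟 γ dom

/-- **NO TAME WHIMPERS** (stub, the KERNEL; open, all admissible data, no genericity). No maximal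
vacuum Cauchy development of an admissible (smooth, complete, one-ended, asymptotically flat)
vacuum datum contains a visible future-incomplete null geodesic with a p.p. curvature blow-up
(alternative (a) of `NoFourthExit`) AND a tame end: a visible vacuum singularity reached along a
transverse null geodesic with all scalar invariants bounded, n-heavy curvature decaying like `ε²`
and only the transverse tidal components `R(γ', e_A, γ', e_B)` unbounded — an outgoing whimper /
weak null front with p.p.-singular but s.p.-regular end — does not develop from such data. Local
vacuum whimpers exist (plane waves `H = f(u)(x² − y²)`, `f ↑ ∞`, all invariants zero), so the
content is global: one-endedness, asymptotic flatness, Bianchi transport along `γ`, Bondi energy. -/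
def NoTameWhimpers : Prop :=
  ∀ (X : Type) [TopologicalSpace X] [ChartedSpace E3 X] [IsManifold (𝓡 3) ∞ X] [T2Space X]
    [SecondCountableTopology X] [ConnectedSpace X],
    ∀ D ∈ admissibleVacuumData X, ∀ 𝒟 : VacuumCauchyDevelopment D, 𝒟.IsMaximal →
      ∀ [𝒟.metric.HasLeviCivita],
        ¬ ∃ (γ : ℝ → 𝒟.carrier) (dom : Set ℝ),
          IsVisibleIncompleteRay 𝒟.toCauchyDevelopment γ dom ∧
            PPBlowup 𝒟.toCauchyDevelopment γ dom ∧ HasTameEnd 𝒟.toCauchyDevelopment γ dom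

/-- **TAME OUTER CENSORS** (the line's pointwise implication; PROVED below from the two stubs and
the two CurvatureOrSymmetry items): for every admissible datum and every MGHD, clause (ii) implies
clause (a). -/
def TameOuterCensors : Prop :=
  ∀ (X : Type) [TopologicalSpace X] [ChartedSpace E3 X] [IsManifold (𝓡 3) ∞ X] [T2Space X]
    [SecondCountableTopology X] [ConnectedSpace X],
    ∀ D ∈ admissibleVacuumData X, ∀ 𝒟 : VacuumCauchyDevelopment D, 𝒟.IsMaximal →
      TameOuter 𝒟.toCauchyDevelopment →
        _root_.Summit.FinalStateConjecture.HasCompleteNullInfinity 𝒟.toCauchyDevelopment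

/-- **The RESIDUAL of K3 once clause (a) is deleted** (stub; the crux's own tame genericity; the
anti-vacuity conjunct is delegated to `MGHDExistence`; owned by the sibling lines of this crux, not
by this line's kernel): tame-Christodoulou-generically on the admissible class, every MGHD is
extremal-chart-free (i) and has a tame outer region (ii).
Difficulty: open-problem (dynamical third law + a-priori tameness, generically, WITHOUT burial:
witness families are fixed-end, continuous-mass, `wDist`-small deformations). -/
def ExtremalFreeTameOuterGeneric : Prop :=
  ∀ (X : Type) [TopologicalSpace X] [ChartedSpace E3 X] [IsManifold (𝓡 3) ∞ X] [T2Space X]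
    [SecondCountableTopology X] [ConnectedSpace X],
    InitialDataSet.IsTameChristodoulouGeneric (admissibleVacuumData X)
      (fun D => ∀ 𝒟 : VacuumCauchyDevelopment D, 𝒟.IsMaximal →
        ExtremalChartFree 𝒟.toSpacetime ∧ TameOuter 𝒟.toCauchyDevelopment) 1

/-! ## Registered stubs

The `stub_*` theorems are the registered obligations (sorried). `Registered.stub_*` are the
name-keyed `abbrev` aliases of their statements, taken as hypotheses of `TameCensorship_of` (the
skeleton audit admits a hypothesis whose head's last name component is a declared stub — device of
`Lines/necks-are-one-way-valves.lean`); the three foreign hypotheses are route items BY NAME. -/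

namespace Registered

/-- Alias of `PancakeLaw` keyed by the registered stub name. -/
abbrev stub_pancakeLaw : Prop := PancakeLaw
/-- Alias of `NoTameWhimpers` keyed by the registered stub name. -/
abbrev stub_noTameWhimpers : Prop := NoTameWhimpers
/-- Alias of `ExtremalFreeTameOuterGeneric` keyed by the registered stub name. -/
abbrev stub_extremalFreeTameOuterGeneric : Prop := ExtremalFreeTameOuterGeneric

end Registered

/-- STUB (the lever; L; provable now over the causal/geodesic/chart libraries): the pancake law. -/
theorem stub_pancakeLaw : PancakeLaw := by
  sorry

/-- STUB (HARDEST — the open kernel of the line, ∀-data): no visible tame whimpers from admissible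
vacuum data. -/
theorem stub_noTameWhimpers : NoTameWhimpers := by
  sorry

/-- STUB (the residual of K3 minus (a), tame-generic; open-problem; the sibling lines' business):
tame-generic third law (i) and a-priori tameness (ii). -/
theorem stub_extremalFreeTameOuterGeneric : ExtremalFreeTameOuterGeneric := by
  sorry

/-! ## Compositions (proved, no `sorry`) -/

/-- **(ii) ⇒ (a), pointwise**, from the lever, the kernel and the two CurvatureOrSymmetry items:
if `𝓘⁺` were incomplete, `NoFourthExit` gives a visible incomplete `γ` ending by curvature (a) or by
symmetry (c); `NoVacuumFountains` forbids (c) ∧ ¬(a), so (a) holds; the pancake law turns clause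
(ii) into a tame end of `γ`; `NoTameWhimpers` forbids (a) together with a tame end. -/
theorem tameOuterCensors_of (hP : PancakeLaw) (hW : NoTameWhimpers) (hN : NoFourthExit)
    (hF : NoVacuumFountains) : TameOuterCensors := by
  intro X _ _ _ _ _ _ D hD 𝒟 hmax hT
  by_contra hinc
  haveI hLC : 𝒟.metric.HasLeviCivita := 𝒟.metric.hasLeviCivita
  obtain ⟨γ, dom, hvis, halt⟩ := hN X D hD 𝒟 hmax hinc
  have hvis' : IsVisibleIncompleteRay 𝒟.toCauchyDevelopment γ dom := hvis
  have hpp : PPBlowup 𝒟.toCauchyDevelopment γ dom := by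
    rcases halt with h | hkh
    · exact h
    · by_contra hnot
      exact hF X D hD 𝒟 hmax ⟨γ, dom, hvis, hnot, hkh⟩
  exact hW X D hD 𝒟 hmax ⟨γ, dom, hvis', hpp, hP X D 𝒟.toCauchyDevelopment hT γ dom hvis'⟩

/-! ## The composition: the three stubs and the three foreign items conclude the crux by name -/

/-- **`TameCensorship` from the line** (real proof, no `sorry`; the ONLY theorem of this file
concluding the crux decl): the pancake law and the no-whimper kernel (stubs), with `NoFourthExit` /
`NoVacuumFountains` (route CurvatureOrSymmetry, by name), give (ii) ⇒ (a) for every admissible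
datum and MGHD (`tameOuterCensors_of`); then pure monotonicity of TAME genericity
(`IsTameChristodoulouGeneric.mono`): on admissible data the residual property (stub) and
`MGHDExistence` (by name) give the anti-vacuity conjunct, `TameOuterCensors` upgrades (ii) to (a),
and the literal clauses (i), (ii) of the crux are recognised by `defeq`. -/
theorem TameCensorship_of :
    Registered.stub_pancakeLaw → Registered.stub_noTameWhimpers → NoFourthExit →
      NoVacuumFountains → MGHDExistence → Registered.stub_extremalFreeTameOuterGeneric →
      Summit.FinalStateConjecture.FinalStateConjecture.Theses.PhotonSphereChannels.TameCensorship := by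
  intro hP hW hN hF hM hG X _ _ _ _ _ _
  have hc : TameOuterCensors := tameOuterCensors_of hP hW hN hF
  refine (hG X).mono ?_
  rintro D hD hall
  exact ⟨hM X D hD, fun 𝒟 hmax =>
    ⟨hc X D hD 𝒟 hmax (hall 𝒟 hmax).2, (hall 𝒟 hmax).1, (hall 𝒟 hmax).2⟩⟩

/-- The pre-23:19Z (rev ≤ 14) topology-free form of K3 follows as well: tame genericity implies
Christodoulou's topology-free genericity (`IsTameChristodoulouGeneric.isChristodoulouGeneric`). -/
theorem tameCensorshipTopologyFree_of (h : TameCensorship) :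
    ∀ (X : Type) [TopologicalSpace X] [ChartedSpace E3 X] [IsManifold (𝓡 3) ∞ X] [T2Space X]
      [SecondCountableTopology X] [ConnectedSpace X],
      InitialDataSet.IsChristodoulouGeneric (admissibleVacuumData X)
        (fun D => (∃ 𝒟 : VacuumCauchyDevelopment D, 𝒟.IsMaximal) ∧
          ∀ 𝒟 : VacuumCauchyDevelopment D, 𝒟.IsMaximal →
            _root_.Summit.FinalStateConjecture.HasCompleteNullInfinity 𝒟.toCauchyDevelopment ∧
              ExtremalChartFree 𝒟.toSpacetime ∧ TameOuter 𝒟.toCauchyDevelopment) 1 :=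
  fun X _ _ _ _ _ _ => (h X).isChristodoulouGeneric

/-! ## Read-backs (proved)

The foreign items ARE the statements the composition reads them as (`Iff.rfl`: the local
predicates `IsVisibleIncompleteRay` / `PPBlowup` / `KillingShadow` are verbatim the blocks of route
CurvatureOrSymmetry's items), and the weight table is not vacuous bookkeeping. -/

/-- `NoFourthExit` (stmt-FinalStateConjecture-10210) unfolds, by `Iff.rfl`, to: incomplete `𝓘⁺` ⇒ a
visible future-incomplete null geodesic ending by curvature (`PPBlowup`) or by symmetry
(`KillingShadow`). -/
theorem noFourthExit_iff :
    NoFourthExit ↔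
      ∀ (X : Type) [TopologicalSpace X] [ChartedSpace E3 X] [IsManifold (𝓡 3) ∞ X] [T2Space X]
        [SecondCountableTopology X] [ConnectedSpace X],
        ∀ D ∈ admissibleVacuumData X, ∀ 𝒟 : VacuumCauchyDevelopment D, 𝒟.IsMaximal →
          ¬ _root_.Summit.FinalStateConjecture.HasCompleteNullInfinity 𝒟.toCauchyDevelopment →
            ∀ [𝒟.metric.HasLeviCivita], ∃ (γ : ℝ → 𝒟.carrier) (dom : Set ℝ),
              IsVisibleIncompleteRay 𝒟.toCauchyDevelopment γ dom ∧
                (PPBlowup 𝒟.toCauchyDevelopment γ dom ∨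
                  KillingShadow 𝒟.toCauchyDevelopment γ dom) :=
  Iff.rfl

/-- `NoVacuumFountains` (stmt-FinalStateConjecture-10211) unfolds, by `Iff.rfl`, to: no visible
future-incomplete null geodesic of an MGHD of admissible data ends by symmetry without ending by
curvature. -/
theorem noVacuumFountains_iff :
    NoVacuumFountains ↔
      ∀ (X : Type) [TopologicalSpace X] [ChartedSpace E3 X] [IsManifold (𝓡 3) ∞ X] [T2Space X]
        [SecondCountableTopology X] [ConnectedSpace X],
        ∀ D ∈ admissibleVacuumData X, ∀ 𝒟 : VacuumCauchyDevelopment D, 𝒟.IsMaximal →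
          ∀ [𝒟.metric.HasLeviCivita], ¬ ∃ (γ : ℝ → 𝒟.carrier) (dom : Set ℝ),
            IsVisibleIncompleteRay 𝒟.toCauchyDevelopment γ dom ∧
              ¬ PPBlowup 𝒟.toCauchyDevelopment γ dom ∧ KillingShadow 𝒟.toCauchyDevelopment γ dom :=
  Iff.rfl

/-- The pointwise implication is all that separates K3 from its (a)-free residual: conversely the
crux gives the residual outright (forget (a) and the anti-vacuity conjunct), so — given
`TameOuterCensors` and `MGHDExistence` — the residual is an EQUIVALENT form of K3 (the card's
Transfer, typed). -/
theorem residual_of_tameCensorship (h : TameCensorship) : ExtremalFreeTameOuterGeneric := by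
  intro X _ _ _ _ _ _
  refine (h X).mono ?_
  rintro D - ⟨-, hall⟩ 𝒟 hmax
  exact ⟨(hall 𝒟 hmax).2.1, (hall 𝒟 hmax).2.2⟩

section ReadBack

variable {X : Type} [TopologicalSpace X] [ChartedSpace E3 X] [IsManifold (𝓡 3) ∞ X]
  [ConnectedSpace X] {D : InitialDataSet (𝓡 3) X}

/-- The weight of the pure-`n` tidal slot pattern `R(n, e₂, n, e₂)` is `−2`: the table forces these
components to be `O(ε²)` at a tame end. -/
theorem boostWeight_n_tidal : boostWeight 1 2 1 2 = -2 := by decide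

/-- The weight of the transverse tidal slot pattern `R(ℓ, e₂, ℓ, e₂)` is `+2` (bounded only through
the chart's actual boost `u`). -/
theorem boostWeight_l_tidal : boostWeight 0 2 0 2 = 2 := by decide

/-- The weight of the Coulomb-type slot pattern `R(ℓ, n, ℓ, n)` is `0`: bounded outright. -/
theorem boostWeight_coulomb : boostWeight 0 1 0 1 = 0 := by decide

/-- At a tame end the n-heavy tidal components decay quadratically in the remaining affine length:
`|R(n, e₂, n, e₂)(γ t)| ≤ C³ (sSup dom − t)²` for `t < sSup dom` (read-back of `HasTameEnd`). -/
theorem n_tidal_decay_of_hasTameEnd (𝒟 : CauchyDevelopment D) [𝒟.metric.HasLeviCivita]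
    {γ : ℝ → 𝒟.carrier} {dom : Set ℝ} (h : HasTameEnd 𝒟 γ dom) :
    ∃ C : ℝ, 0 < C ∧ ∀ t ∈ dom, 0 ≤ t → t < sSup dom →
      ∃ f : Fin 4 → TangentSpace (𝓡 4) (γ t), IsAdaptedNullFrame 𝒟 (γ t) (velocity (𝓡 4) γ t) f ∧
        |𝒟.metric.val (γ t)
            (CovariantDerivative.curvature 𝒟.metric.leviCivita (γ t) (f 1) (f 2) (f 1)) (f 2)| ≤
          C ^ 3 * (sSup dom - t) ^ 2 := by
  obtain ⟨C, hC, h⟩ := h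
  refine ⟨C, hC, fun t ht h0 hlt => ?_⟩
  obtain ⟨f, hf, u, hu, htab⟩ := h t ht h0
  refine ⟨f, hf, ?_⟩
  have hε : 0 < sSup dom - t := sub_pos.2 hlt
  have hCε : 0 < C * (sSup dom - t) := mul_pos hC hε
  have hu0 : 0 < u := lt_of_lt_of_le (inv_pos.2 hCε) hu
  have key := htab 1 2 1 2
  rw [boostWeight_n_tidal] at key
  -- `u ^ (-2) = (u ^ 2)⁻¹ ≤ (C (T - t))²`
  have hpow : u ^ (-2 : ℤ) ≤ (C * (sSup dom - t)) ^ 2 := by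
    rw [show (-2 : ℤ) = -((2 : ℕ) : ℤ) by norm_num, zpow_neg, zpow_natCast]
    have h1 : (C * (sSup dom - t))⁻¹ ^ 2 ≤ u ^ 2 := by
      exact pow_le_pow_left₀ (le_of_lt (inv_pos.2 hCε)) hu 2
    rw [inv_pow] at h1
    have h2 : 0 < u ^ 2 := pow_pos hu0 2
    calc (u ^ 2)⁻¹ ≤ ((C * (sSup dom - t)) ^ 2)⁻¹⁻¹ := by
            exact inv_anti₀ (inv_pos.2 (pow_pos hCε 2)) h1
      _ = (C * (sSup dom - t)) ^ 2 := inv_inv _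
  calc |𝒟.metric.val (γ t)
          (CovariantDerivative.curvature 𝒟.metric.leviCivita (γ t) (f 1) (f 2) (f 1)) (f 2)|
        ≤ C * u ^ (-2 : ℤ) := key
    _ ≤ C * (C * (sSup dom - t)) ^ 2 := by exact mul_le_mul_of_nonneg_left hpow hC.le
    _ = C ^ 3 * (sSup dom - t) ^ 2 := by ring

end ReadBack

end Summit.FinalStateConjecture.FinalStateConjecture.Cruxes.TameCensorship.TameOuterCensors

end
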